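import Literature.NumberTheory.Automorphic.ResGLnKugaHarmonic
import Literature.NumberTheory.Automorphic.AutomorphicRepInfinitesimalCharacter
import Literature.Algebra.Lie.CasimirElement
import HarnessLib

/-!
# The trace-form Casimir operator acts by a scalar on the forms of a clean automorphic
# representation of `GL_n(𝔸_K)`

Topic `NumberTheory/Automorphic`; namespace `Literature.NumberTheory.Automorphic.ConeDictionary`
(vocabulary of `ResGLnKugaHarmonic`).  Definitional re-typings (defs with bodies) and theorems; no
named fact, no `sorry`.

The hypothesis `hc` of the Step-2 assembly `ResGLnKugaHarmonic.d_eq_zero_and_coclosed_of_casimir_scalar`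
(Borel's injectivity of cuspidal cohomology, `ResGLnCuspidalCohomologyApex`): for an automorphic
representation datum `π = W / W'` of `GL_n(𝔸_K)` with `W' = ⊥`, the Casimir operator
`C_W = ∑_t π(b_t) π(b^t)` of the real trace form (`GKCasimir.op` over the adapted basis `bD` and its
dual `dD`) acts on `W` by a SCALAR:

* `bDBasis`, `trFormD` — the adapted basis and the trace form re-typed over the Lie algebra of the
  datum, `trFormD_nondegenerate/isSymm/lieInvariant`;
* `lift_casimirElement` — the Casimir ELEMENT `Ω = ∑_t ι(b_t) ι(b^t) ∈ U(𝔤)`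
  (`Literature.Algebra.Lie.casimirElement`) acts through any Lie action `ρ` as `GKCasimir.op ρ bD dD`;
  `casimirElement_mem_centerU` — `Ω ∈ Z(𝔤)` (`casimirElement_mem_center`);
* **`exists_op_lieRepW_eq_smul`** — `Z(𝔤)` acts on `W / W'` by scalars
  (`AutomorphicRepData.exists_forall_applyFree_sub_smul_mem`, Borel–Jacquet 4.6 / Langlands Prop. 2,
  proved in `AutomorphicRepInfinitesimalCharacter`), whence for `W' = ⊥`: `C_W = c` on `W`.

[cite: BorelWallach2000, I §2.3; II §2.5] [cite: BorelJacquet1979, 4.6]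

## References

* A. Borel, N. Wallach, *Continuous cohomology, discrete subgroups, and representations of reductive
  groups*, 2nd ed. (2000), I §2.3, II §2.5 (held). [BorelWallach2000]
* A. Borel, H. Jacquet, *Automorphic forms and automorphic representations*, Corvallis (1979), 4.6.
  [BorelJacquet1979]
-/

noncomputable section

namespace Literature.NumberTheory.Automorphic

-- Mathlib idiom (as in `GKModules`): commutator bracket on matrix algebras and `Module.End`
attribute [local instance 100] LieRing.ofAssociativeRing

-- `Classical`: the place subtypes indexing `mixedSpace K` are `Fintype` classically (as in `AdelicGLnGlue`).
open scoped TensorProduct Classical _root_.Matrix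
open _root_.NumberField _root_.NumberField.mixedEmbedding _root_.UniversalEnvelopingAlgebra

namespace ConeDictionary

section Retype

variable (n : ℕ) (K : Type) [Field K] [NumberField K] (hcpt : isCompact_glFiniteIntegralLevel n K)

set_option maxHeartbeats 800000 in
-- one-time re-typing over the datum (definitional)
/-- The adapted basis of `𝔤`, as a basis of the Lie algebra of the datum. [folklore] -/
def bDBasis : Module.Basis (Fin (ResGLnCartan.pZeroDim n K) ⊕ Fin (ResGLnCartan.kDim n K)) ℝ (𝔤D n K hcpt) :=
  ResGLnCartan.adaptedBasis n K

/-- `bDBasis t = bD t`. [folklore] -/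
@[simp] theorem bDBasis_apply (t : Fin (ResGLnCartan.pZeroDim n K) ⊕ Fin (ResGLnCartan.kDim n K)) :
    bDBasis n K hcpt t = bD n K hcpt t := rfl

set_option maxHeartbeats 800000 in
-- as above
/-- The real trace form `B(X, Y) = Re tr_{K_∞/ℝ}(XY)` on the Lie algebra of the datum. [folklore] -/
def trFormD : LinearMap.BilinForm ℝ (𝔤D n K hcpt) := ResGLnCartan.trForm n K

set_option maxHeartbeats 800000 in
-- as above
/-- `B` is non-degenerate. [folklore] -/
theorem trFormD_nondegenerate : (trFormD n K hcpt).Nondegenerate := ResGLnCartan.trForm_nondegenerate (n := n) (K := K)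

set_option maxHeartbeats 800000 in
-- as above
/-- `B` is symmetric. [folklore] -/
theorem trFormD_isSymm : (trFormD n K hcpt).IsSymm := ResGLnCartan.trForm_isSymm (n := n) (K := K)

set_option maxHeartbeats 800000 in
-- as above
/-- `B` is invariant. [folklore] -/
theorem trFormD_lieInvariant : (trFormD n K hcpt).lieInvariant (𝔤D n K hcpt) :=
  fun X Y Z => ResGLnCartan.trForm_lieInvariant (n := n) (K := K) X Y Z

set_option maxHeartbeats 800000 in
-- as above
/-- The `B`-dual basis of `bDBasis` is `dD`. [folklore] -/
@[simp] theorem dualBasis_bDBasis (t : Fin (ResGLnCartan.pZeroDim n K) ⊕ Fin (ResGLnCartan.kDim n K)) :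
    (trFormD n K hcpt).dualBasis (trFormD_nondegenerate n K hcpt) (bDBasis n K hcpt) t = dD n K hcpt t := rfl

/-- **The Casimir element `Ω = ∑_t ι(b_t) ι(b^t) ∈ U(𝔤)` acts through a Lie action `ρ` as the
Casimir operator `∑_t ρ(b_t) ρ(b^t)`.** [cite: BorelWallach2000, I §2.3] -/
theorem lift_casimirElement {V : Type*} [AddCommGroup V] [Module ℂ V] (ρ : 𝔤D n K hcpt →ₗ⁅ℝ⁆ Module.End ℂ V) :
    lift ℝ ρ (Literature.Algebra.Lie.casimirElement (trFormD n K hcpt) (trFormD_nondegenerate n K hcpt) (bDBasis n K hcpt)) =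
      GKCasimir.op (AutomorphyDatum.gl n K hcpt).arch ρ (bD n K hcpt) (dD n K hcpt) := by
  rw [Literature.Algebra.Lie.casimirElement_eq_sum_ιMul, map_sum, GKCasimir.op]
  refine Finset.sum_congr rfl fun t _ => ?_
  rw [Literature.Algebra.Lie.ιMul_apply, map_mul, lift_ι_apply, lift_ι_apply, dualBasis_bDBasis, bDBasis_apply]

/-- **`Ω ∈ Z(𝔤)`.** [cite: BorelWallach2000, I §2.3] -/
theorem casimirElement_mem_centerU :
    Literature.Algebra.Lie.casimirElement (trFormD n K hcpt) (trFormD_nondegenerate n K hcpt) (bDBasis n K hcpt) ∈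
      centerU (AutomorphyDatum.gl n K hcpt).arch :=
  Literature.Algebra.Lie.casimirElement_mem_center (trFormD_isSymm n K hcpt) (trFormD_lieInvariant n K hcpt) _

end Retype

variable {n : ℕ} {K : Type} [Field K] [NumberField K] {hcpt : isCompact_glFiniteIntegralLevel n K}
  (π : AutomorphicRepData (AutomorphyDatum.gl n K hcpt))

/-- **The trace-form Casimir operator acts on the forms `W` of a clean (`W' = ⊥`) automorphic
representation of `GL_n(𝔸_K)` by a scalar** — `Z(𝔤)` acts on the irreducible `W / W'` by scalars
(Borel–Jacquet 4.6, `AutomorphicRepData.exists_forall_applyFree_sub_smul_mem`) and `Ω ∈ Z(𝔤)`.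
This is the hypothesis `hc` of `d_eq_zero_and_coclosed_of_casimir_scalar`.
[cite: BorelJacquet1979, 4.6] [cite: BorelWallach2000, II §2.5] -/
theorem exists_op_lieRepW_eq_smul (hW' : π.W' = ⊥) :
    ∃ c : ℂ, ∀ v : π.W,
      GKCasimir.op (AutomorphyDatum.gl n K hcpt).arch π.lieRepW (bD n K hcpt) (dD n K hcpt) v = c • v := by
  obtain ⟨p, hp⟩ := freeToEnveloping_surjective (AutomorphyDatum.gl n K hcpt).arch
    (Literature.Algebra.Lie.casimirElement (trFormD n K hcpt) (trFormD_nondegenerate n K hcpt) (bDBasis n K hcpt))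
  have hpc : IsCentralWord p := by
    change freeToEnveloping _ p ∈ centerU (AutomorphyDatum.gl n K hcpt).arch
    rw [hp]
    exact casimirElement_mem_centerU n K hcpt
  obtain ⟨c, hc⟩ := π.exists_forall_applyFree_sub_smul_mem hpc
  refine ⟨c, fun v => ?_⟩
  have h := hc v v.2
  rw [hW', Submodule.mem_bot, sub_eq_zero] at h
  apply Subtype.ext
  rw [← lift_casimirElement n K hcpt π.lieRepW, ← hp, π.coe_lift_lieRepW_freeToEnveloping p v, h, Submodule.coe_smul]

end ConeDictionary

end Literature.NumberTheory.Automorphic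

end
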